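import Literature.NumberTheory.Automorphic.CDTTheorem712OggThreeProofs
import Literature.NumberTheory.EllipticCurves.HasseWeilAbelianConductorWildProofs
import HarnessLib

/-!
# Conrad–Diamond–Taylor Theorem 7.1.2: the conductor step proved, and Theorem 7.1.2 (with 7.2.4,
# Theorem A, Theorem B) on its printed deep inputs alone

Topic `NumberTheory/Automorphic`; a `…Proofs` companion (theorems only: no definitions, no named
facts, no instances) of `Literature.NumberTheory.Automorphic.CDTTheorem712OggThreeProofs`, landed by
the tenured seat of the named fact `Literature.NumberTheory.Automorphic.BCDT.CDT_theorem_7_1_2`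
(Conrad–Diamond–Taylor 1999, Thm. 7.1.2: "Let `E/ℚ` be an elliptic curve whose conductor is not
divisible by `27`. Then `E` is modular.") as the next bottom-up step in the printed proof
architecture of that fact.

B. Conrad, F. Diamond, R. Taylor, *Modularity of certain potentially Barsotti–Tate Galois
representations*, J. Amer. Math. Soc. 12 (1999), 521–567 [ConradDiamondTaylor1999], p. 556, prove
Theorem 7.1.2 from four deep inputs — Theorem 7.2.1 (Thm. 7.1.1 at `ℓ = 3` with Langlands–Tunnell),
Lemma 7.2.3 (Elkies), Wiles' `3`–`5` switch, Theorem 7.2.2 (Thm. 7.1.1 at `ℓ = 5`) — and one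
arithmetic sentence, *"Since `ρ̄_{E',5} ≅ ρ̄_{E,5}`, the conductor of `E'` is not divisible by
`27`"* (the conductor step).  `CDTTheorem712OggThreeProofs` proved that sentence, and re-ran every
assembly of `CDTTheorem712` built on it, granted ONE Galois-side named fact: Ogg's formula for the
wild part of the conductor at the additive places of residue characteristic `3`,
`∀ W : WeierstrassCurve ℚ, W.swanConductorAt_rationalTate_eq_wildConductorExponent_of_ringChar_eq_three 5`
(`HasseWeilAbelianConductorOggSaito`; Ogg 1967, Silverman *ATAEC* IV.11.1, case `p = 3`).

That fact is now a **theorem** of the tree, for every elliptic curve over every number field and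
every prime `ℓ`:
`WeierstrassCurve.swanConductorAt_rationalTate_eq_wildConductorExponent_of_ringChar_eq_three_holds`
(`OggFormulaWildThreeProofs`, the seat of bsd.S15: Silverman's case-by-case proof of IV.11.1 for
`p = 3` at `ℓ = 2` — Tate's normal forms, the Eisenstein `2`-division cubic, the ramification of its
splitting field in residue characteristic `3` — transported to every `ℓ` by the `ℓ`-independence of
the wild conductor away from `2`), together with its placewise corollary
`WeierstrassCurve.swanConductorAt_rationalTate_eq_wildConductorExponent_of_ringChar_ne_two`
(`HasseWeilAbelianConductorWildProofs`: `Sw_𝔓(V_ℓ E) = δ_v` at every `𝔓 ∣ v ∤ 2ℓ`).  This file feeds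
the discharge in.  Results, all without any Galois-side hypothesis:

* `WeierstrassCurve.wildConductorExponent_eq_of_isTorsionGaloisRep` — **the wild conductor exponent
  depends only on `E[ℓ]`**: for elliptic curves `E, E'` over a number field `K` with a common framed
  model `ρ̄` of `E[ℓ]` and `E'[ℓ]`, `δ_v(E) = δ_v(E')` at every finite place `v ∤ 2ℓ` (Swan
  invariance `swanConductorAt_rationalTate_eq_of_isTorsionGaloisRep` of `CDTSwanConductorProofs` +
  Ogg's formula at `v`); `…_two` (`ℓ = 2`, every `v ∤ 2`) and `…_int` (over `ℚ`, places of `ℤ`);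
* `WeierstrassCurve.twentySeven_dvd_conductorNorm_iff_of_isTorsionGaloisRep_of_ne_three` —
  **`27 ∣ N_E` depends only on `E[ℓ]`** (`ℓ ≠ 3`) for elliptic curves over `ℚ`;
* `CDT_theorem_7_1_2_conductorStep` — **the conductor step of p. 556, proved**: `ρ̄_{E',5} ≅ ρ̄_{E,5}`
  and `27 ∤ N_E` give `27 ∤ N_{E'}`;
* `CDT_theorem_7_1_2_of_CDT721_722_723_switch` — **Theorem 7.1.2 from exactly the four results its
  printed proof invokes**, `CDT_theorem_7_2_1 → CDT_theorem_7_2_2 → CDT_lemma_7_2_3_isModular →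
  CDT_three_five_switch → CDT_theorem_7_1_2`, every other sentence of the proof on p. 556 being a
  theorem of the tree; `…_auxiliaryCurve` (the switch supplied by the Shepherd-Barron–Taylor curve of
  `BCDTTheoremB`) and `CDT_theorem_7_1_2_iff_CDT721` (granted 7.2.2, 7.2.3 and the switch, Thm. 7.1.2
  is equivalent to its "weaker version" Thm. 7.2.1, p. 553);
* `exists_mem_absUpperRamificationSubgroup_ne_one_of_twentySeven_dvd_conductorNorm`,
  `not_twentySeven_dvd_conductorNorm_of_isTamelyRamifiedAbove_three`,
  `exists_orderOf_eq_three_of_twentySeven_dvd_conductorNorm`,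
  `isAbsIrreducibleOverSqrt_five_of_twentySeven_dvd_conductorNorm`,
  `not_twentySeven_dvd_conductorNorm_of_not_isAbsIrreducibleOverSqrt_five` — **`27 ∣ N_E` forces
  wild ramification of `E[5]` above `3`**, hence an element of order `3` in the image of `ρ̄_{E,5}`,
  hence absolute irreducibility of `ρ̄_{E,5}|_{ℚ(√5)}` (the hidden lemma of Thm. 7.2.4; the tame case
  of BCDT Thm. 2.2.1), unconditionally;
* `CDT_theorem_7_2_4_of_CDT712_722` — **Theorem 7.2.4 "immediate from Theorem 7.1.2"** (p. 556) and
  Thm. 7.2.2, nothing else; `CDT_theorem_7_2_4_of_CDT721_722_723_switch`;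
* `isModular_of_theoremB_CDT712_722`, `exists_isNewformOf_of_theoremB_CDT712_722` — **BCDT Theorem A
  from Theorem B, CDT Thm. 7.1.2 and CDT Thm. 7.2.2**, BCDT's printed deduction ("Theorem A follows
  from Theorem B and Theorem 7.2.4 of [CDT]") with no further input;
  `exists_isNewformOf_of_theoremB_CDT721_722_723_switch`;
* `exists_isTorsionGaloisRep_and_isModular_of_isTamelyRamifiedAbove_of_auxiliaryCurve_CDT721`,
  `theoremB_of_wild_auxiliaryCurve_CDT721`,
  `exists_isNewformOf_of_wild_auxiliaryCurve_CDT721_722_723` and the two lang.S33 forms — Theorem B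
  from {its wild case, the auxiliary curve, CDT Thm. 7.2.1} and the Modularity Theorem from {the
  wild case, the auxiliary curve, CDT Thms. 7.2.1, 7.2.2, Lemma 7.2.3}.

Trust base of `CDT_theorem_7_1_2` inside the tree after this file: {CDT Thm. 7.2.1, CDT Thm. 7.2.2,
CDT Lemma 7.2.3 (modularity conclusion), the `3`–`5` switch of p. 556 (or the Shepherd-Barron–Taylor
auxiliary curve)} — four modularity / Diophantine inputs (modularity lifting for potentially
Barsotti–Tate representations at `ℓ = 3, 5` with Langlands–Tunnell; Elkies' rational points on
`X₀(15)`, `X₀(45)/w₉`, `X₀(75)/w₂₅`; the genus-`0` twist of `X(5)` with Hilbert irreducibility),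
none of which is in Mathlib; no conductor / Galois-module input remains.  (With BCDT Theorem B
granted instead of the switch, `BCDTTheoremACasesProofs` reaches Thm. 7.1.2 from {Thm. B, 7.2.1,
7.2.2, 7.2.3} without the conductor step; that route and the finer `lift`/(3) ⇒ (2) splitting of
Thm. 7.2.2 in `CDTTheorem722Proofs` are not touched here.)

## References

* [ConradDiamondTaylor1999] B. Conrad, F. Diamond, R. Taylor, J. Amer. Math. Soc. 12 (1999):
  Introduction (p. 522: `27 ∤ N_E` "if and only if `E` acquires semistable reduction over a tamely
  ramified extension of `ℚ₃`"), Thm. 7.1.2 (p. 551), Thm. 7.2.1, Thm. 7.2.2 (p. 553), Lemma 7.2.3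
  (p. 554), proof of Thm. 7.1.2 and Thm. 7.2.4 (p. 556).
* [BCDTJAMS2001] C. Breuil, B. Conrad, F. Diamond, R. Taylor, J. Amer. Math. Soc. 14 (2001):
  Thm. A, §2.2 (Thm. 2.2.1, case 1; Thm. 2.2.2).
* [SilvermanATAEC1994] J. H. Silverman, *Advanced Topics in the Arithmetic of Elliptic Curves*,
  §IV.10 (Definition, Thm. 10.2, PDF p. 358), §IV.11 (Ogg's formula 11.1, PDF p. 365; proof for
  `p ≥ 3`, pp. 366–371).
* [OggAJM1967] A. P. Ogg, *Elliptic curves and wild ramification*, Amer. J. Math. 89 (1967), Thm. 2.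

## Design

Pure theorems; `noncomputable section`; one universe `u`; namespaces `WeierstrassCurve`,
`Literature.NumberTheory.Automorphic.BCDT` (next to the `_of_ogg3` theorems they discharge) and
`Literature.NumberTheory.Automorphic` (the lang.S33 corollaries); no instances, no `sorry`.  Every
proof is the corresponding `_of_ogg3` theorem of `CDTTheorem712OggThreeProofs` fed with
`oggThree_five`.  Axioms of every theorem: `propext`, `Classical.choice`, `Quot.sound`.
-/

noncomputable section

open scoped NumberField MatrixGroups
open Field IsDedekindDomain Matrix

universe u

/-! ## The wild conductor exponent depends only on `E[ℓ]` -/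

namespace WeierstrassCurve

open Literature.NumberTheory.EllipticCurves Literature.NumberTheory.GaloisRepresentations
  Literature.NumberTheory.DiophantineGeometry

section NumberField

variable {K : Type u} [Field K] [NumberField K]

/-- **The wild conductor exponent depends only on `E[ℓ]`, away from `2`.**  For elliptic curves
`E, E'` over a number field `K`, a prime `ℓ` and a common framed model `ρ̄` of `E[ℓ]` and `E'[ℓ]`
(`IsTorsionGaloisRep`: `E[ℓ] ≅ E'[ℓ]` as `Γ_K`-modules), `δ_v(E) = δ_v(E')` at every finite place
`v ∤ ℓ` of residue characteristic `≠ 2`.  With Silverman's definition of `δ_v` through the Swan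
conductor (*ATAEC* §IV.10, PDF p. 358) this is the remark that `δ` is read off from `E[ℓ]`; in the
tree `δ_v := f_v - ε_v` is computed by Tate's algorithm (`DiophantineGeometry/Conductor`), and the
content is the Swan invariance `swanConductorAt_rationalTate_eq_of_isTorsionGaloisRep`
(`CDTSwanConductorProofs`) together with Ogg's formula `Sw_𝔓(V_ℓ E) = δ_v` at `v`, a theorem of the
tree at every place of residue characteristic `≠ 2`
(`swanConductorAt_rationalTate_eq_wildConductorExponent_of_ringChar_ne_two`,
`HasseWeilAbelianConductorWildProofs`, after `OggFormulaWildThreeProofs`).  Supersedes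
`wildConductorExponent_eq_of_isTorsionGaloisRep_of_swan` (there on Ogg's formula at all places) and
`wildConductorExponent_eq_of_isTorsionGaloisRep_of_ringChar_eq_three` (there on the `p = 3` fact).
[cite: SilvermanATAEC1994, §IV.10 Definition of the conductor (PDF p. 358) and IV.11.1 for p ≥ 3 (pp. 365–371)] -/
theorem wildConductorExponent_eq_of_isTorsionGaloisRep (W W' : WeierstrassCurve K) [W.IsElliptic]
    [W'.IsElliptic] (ℓ : ℕ) [Fact ℓ.Prime] {ρ : FramedGaloisRep K (ZMod ℓ) 2}
    (hρ : W.IsTorsionGaloisRep ℓ ρ) (hρ' : W'.IsTorsionGaloisRep ℓ ρ) (v : HeightOneSpectrum (𝓞 K))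
    (hℓv : (ℓ : 𝓞 K) ∉ v.asIdeal) (hv2 : ringChar (𝓞 K ⧸ v.asIdeal) ≠ 2) :
    W.wildConductorExponent v = W'.wildConductorExponent v := by
  have h𝔓 := (HeightOneSpectrum.primesAbove_nonempty v).some_mem
  have e1 := W.swanConductorAt_rationalTate_eq_wildConductorExponent_of_ringChar_ne_two ℓ v hℓv hv2 h𝔓
  have e2 := W'.swanConductorAt_rationalTate_eq_wildConductorExponent_of_ringChar_ne_two ℓ v hℓv hv2
    h𝔓
  have := swanConductorAt_rationalTate_eq_of_isTorsionGaloisRep W W' ℓ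
    (W.continuous_rationalGaloisRepTate_holds ℓ) (W'.continuous_rationalGaloisRepTate_holds ℓ) hρ hρ'
    hℓv h𝔓
  rw [e1, e2] at this
  exact_mod_cast this

/-- **The wild conductor exponent is determined by the `2`-torsion**: for elliptic curves `E, E'`
over a number field with `E[2] ≅ E'[2]` as `Γ_K`-modules, `δ_v(E) = δ_v(E')` at every finite place
`v ∤ 2` (a place not above `2` has residue characteristic `≠ 2`, `ringChar_ne_of_natCast_notMem`).
[cite: SilvermanATAEC1994, §IV.10 Definition of the conductor (PDF p. 358) and IV.11.1 for p ≥ 3 (pp. 365–371)] -/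
theorem wildConductorExponent_eq_of_isTorsionGaloisRep_two (W W' : WeierstrassCurve K)
    [W.IsElliptic] [W'.IsElliptic] {ρ : FramedGaloisRep K (ZMod 2) 2}
    (hρ : W.IsTorsionGaloisRep 2 ρ) (hρ' : W'.IsTorsionGaloisRep 2 ρ) (v : HeightOneSpectrum (𝓞 K))
    (h2v : ((2 : ℕ) : 𝓞 K) ∉ v.asIdeal) :
    W.wildConductorExponent v = W'.wildConductorExponent v :=
  wildConductorExponent_eq_of_isTorsionGaloisRep W W' 2 hρ hρ' v h2v
    (v.ringChar_ne_of_natCast_notMem h2v)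

end NumberField

section Rat

open Rat.HeightOneSpectrum

/-- **`27 ∣ N_E` depends only on `E[ℓ]` (`ℓ ≠ 3`), unconditionally**: for elliptic curves `E, E'`
over `ℚ` with a common framed model `ρ̄` of `E[ℓ]` and `E'[ℓ]`, `27 ∣ N_E ↔ 27 ∣ N_{E'}`.  This is
`twentySeven_dvd_conductorNorm_iff_of_isTorsionGaloisRep_of_ogg3` (`CDTTheorem712OggThreeProofs`)
with both instances of Ogg's formula at `p = 3` discharged by
`swanConductorAt_rationalTate_eq_wildConductorExponent_of_ringChar_eq_three_holds`
(`OggFormulaWildThreeProofs`).  CDT, Introduction, p. 522: `27 ∤ N_E` "if and only if `E` acquires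
semistable reduction over a tamely ramified extension of `ℚ₃`", a condition visible on `E[ℓ]`.
[cite: ConradDiamondTaylor1999, Introduction (p. 522)] -/
theorem twentySeven_dvd_conductorNorm_iff_of_isTorsionGaloisRep_of_ne_three
    (W W' : WeierstrassCurve ℚ) [W.IsElliptic] [W'.IsElliptic] {ℓ : ℕ} [Fact ℓ.Prime] (hℓ3 : ℓ ≠ 3)
    {ρ : FramedGaloisRep ℚ (ZMod ℓ) 2} (hρ : W.IsTorsionGaloisRep ℓ ρ)
    (hρ' : W'.IsTorsionGaloisRep ℓ ρ) :
    27 ∣ W.conductorNorm ℤ ↔ 27 ∣ W'.conductorNorm ℤ :=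
  twentySeven_dvd_conductorNorm_iff_of_isTorsionGaloisRep_of_ogg3 W W' hℓ3
    (W.swanConductorAt_rationalTate_eq_wildConductorExponent_of_ringChar_eq_three_holds ℓ)
    (W'.swanConductorAt_rationalTate_eq_wildConductorExponent_of_ringChar_eq_three_holds ℓ) hρ hρ'

/-- `wildConductorExponent_eq_of_isTorsionGaloisRep` over `ℚ` at the places of `ℤ` (the indexing of
`N_E = W.conductorNorm ℤ`): two elliptic curves over `ℚ` with a common framed model of their
`ℓ`-torsion have the same wild conductor exponent `δ_p` at every prime `p ∉ {2, ℓ}`, unconditionally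
(compare `wildConductorExponent_eq_of_isTorsionGaloisRep_of_swan_int`, `CDTSwanConductorProofs`,
there on Ogg's formula at all places). [folklore] -/
theorem wildConductorExponent_eq_of_isTorsionGaloisRep_int (W W' : WeierstrassCurve ℚ)
    [W.IsElliptic] [W'.IsElliptic] (ℓ : ℕ) [Fact ℓ.Prime] {ρ : FramedGaloisRep ℚ (ZMod ℓ) 2}
    (hρ : W.IsTorsionGaloisRep ℓ ρ) (hρ' : W'.IsTorsionGaloisRep ℓ ρ) (v : HeightOneSpectrum ℤ)
    (hv : natGenerator v ≠ ℓ) (hv2 : natGenerator v ≠ 2) :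
    W.wildConductorExponent v = W'.wildConductorExponent v := by
  set v' : HeightOneSpectrum (𝓞 ℚ) := (primesEquiv (R := 𝓞 ℚ)).symm (primesEquiv v) with hv'
  have hvv' : (primesEquiv v : Nat.Primes) = primesEquiv v' := by
    rw [hv', Equiv.apply_symm_apply]
  -- a prime `p` lies in `v'` only if it generates `v`
  have hmem : ∀ {p : ℕ} (hp : p.Prime), ((p : ℕ) : 𝓞 ℚ) ∈ v'.asIdeal → natGenerator v = p := by
    intro p hp h
    rw [natCast_mem_asIdeal_iff_eq_primesEquiv_symm v' hp, hv',
      (primesEquiv (R := 𝓞 ℚ)).symm.injective.eq_iff] at h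
    change ((primesEquiv v : Nat.Primes) : ℕ) = p
    rw [h]
  have hℓv' : ((ℓ : ℕ) : 𝓞 ℚ) ∉ v'.asIdeal := fun h ↦ hv (hmem Fact.out h)
  have h2v' : ((2 : ℕ) : 𝓞 ℚ) ∉ v'.asIdeal := fun h ↦ hv2 (hmem Nat.prime_two h)
  rw [wildConductorExponent_eq_of_primesEquiv_eq v v' W hvv',
    wildConductorExponent_eq_of_primesEquiv_eq v v' W' hvv']
  exact wildConductorExponent_eq_of_isTorsionGaloisRep W W' ℓ hρ hρ' v' hℓv'
    (v'.ringChar_ne_of_natCast_notMem h2v')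

end Rat

end WeierstrassCurve

namespace Literature.NumberTheory.Automorphic.BCDT

open WeierstrassCurve GaloisRepresentations

/-! ## The Galois-side input of `CDTTheorem712OggThreeProofs` is a theorem -/

/-- **Ogg's formula at the additive places of residue characteristic `3`, `ℓ = 5`, for every
elliptic curve over `ℚ`** — the hypothesis `hOgg3` of every `_of_ogg3` theorem of
`CDTTheorem712OggThreeProofs`, now supplied by the discharge
`WeierstrassCurve.swanConductorAt_rationalTate_eq_wildConductorExponent_of_ringChar_eq_three_holds`
(`OggFormulaWildThreeProofs`).
[cite: SilvermanATAEC1994, Thm. IV.11.1 and its proof for p = 3 (PDF pp. 366–371)] -/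
theorem oggThree_five (W : WeierstrassCurve ℚ) :
    W.swanConductorAt_rationalTate_eq_wildConductorExponent_of_ringChar_eq_three 5 :=
  W.swanConductorAt_rationalTate_eq_wildConductorExponent_of_ringChar_eq_three_holds 5

/-! ## The conductor step of Theorem 7.1.2, proved -/

/-- **Conrad–Diamond–Taylor 1999, proof of Theorem 7.1.2, the conductor step — proved** (JAMS 12
(1999), p. 556: *"Since `ρ̄_{E',5} ≅ ρ̄_{E,5}`, the conductor of `E'` is not divisible by `27`"*):
for elliptic curves `E, E'` over `ℚ` with `ρ̄_{E',5} ≅ ρ̄_{E,5}` (a common framed model `ρ̄` of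
`E[5]` and `E'[5]`, `IsTorsionGaloisRep`) and `27 ∤ N_E`, also `27 ∤ N_{E'}`.  No hypothesis left:
`not_dvd_conductorNorm_of_isTorsionGaloisRep_five_of_ogg3` with Ogg's formula at `p = 3` discharged.
[cite: ConradDiamondTaylor1999, proof of Thm. 7.1.2 (p. 556)] -/
theorem CDT_theorem_7_1_2_conductorStep (W W' : WeierstrassCurve ℚ) [W.IsElliptic] [W'.IsElliptic]
    {ρ : ModPGaloisRep ℚ (ZMod 5) 2} (hρ : W.IsTorsionGaloisRep 5 ρ)
    (hρ' : W'.IsTorsionGaloisRep 5 ρ) (h27 : ¬ 27 ∣ W.conductorNorm ℤ) :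
    ¬ 27 ∣ W'.conductorNorm ℤ :=
  not_dvd_conductorNorm_of_isTorsionGaloisRep_five_of_ogg3 W W' (oggThree_five W) (oggThree_five W')
    hρ hρ' h27

/-! ## Theorem 7.1.2 from exactly its four printed inputs -/

/-- **Conrad–Diamond–Taylor 1999, Theorem 7.1.2 from Theorem 7.2.1, Theorem 7.2.2, Lemma 7.2.3 and
the `3`–`5` switch — nothing else.**  The printed proof (JAMS 12 (1999), p. 556), PROVED granted
exactly the four results it invokes, as the named facts `CDT_theorem_7_2_1` (`BCDTTheoremB`),
`CDT_theorem_7_2_2` (`BCDTModularity` Part 4), `CDT_lemma_7_2_3_isModular` and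
`CDT_three_five_switch` (`CDTTheorem712`): *"According to Theorem 7.2.1, we may suppose that
`ρ̄_{E,3}|_{ℚ(√-3)}` is not absolutely irreducible. By Lemma 7.2.3, we may assume `ρ̄_{E,5}|_{ℚ(√5)}`
is absolutely irreducible. … there is an elliptic curve `E'/ℚ` with `ρ̄_{E',5} ≅ ρ̄_{E,5}` and
`ρ̄_{E',3}|_{ℚ(√-3)}` absolutely irreducible … Since `ρ̄_{E',5} ≅ ρ̄_{E,5}`, the conductor of `E'` is
not divisible by `27`"* (`CDT_theorem_7_1_2_conductorStep`) *"Therefore `E'` is modular by Theorem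
7.2.1, so `ρ̄_{E,5} ≅ ρ̄_{E',5}` is modular"* (`IsModular.isModular_of_isTorsionGaloisRep''`)
*"Therefore `E` is modular by Theorem 7.2.2."*  This is
`CDT_theorem_7_1_2_of_7_2_1_of_7_2_2_of_7_2_3_of_switch_of_ogg3` with its Galois-side input
discharged (`oggThree_five`). [cite: ConradDiamondTaylor1999, Thm. 7.1.2 (proof, p. 556)] -/
theorem CDT_theorem_7_1_2_of_CDT721_722_723_switch (h721 : CDT_theorem_7_2_1)
    (h722 : CDT_theorem_7_2_2) (h723 : CDT_lemma_7_2_3_isModular) (hsw : CDT_three_five_switch) :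
    CDT_theorem_7_1_2 :=
  CDT_theorem_7_1_2_of_7_2_1_of_7_2_2_of_7_2_3_of_switch_of_ogg3 h721 h722 h723 hsw oggThree_five

/-- **Theorem 7.1.2 from Theorem 7.2.1, Theorem 7.2.2, Lemma 7.2.3 and the Shepherd-Barron–Taylor
auxiliary curve** (`exists_isTorsionGaloisRep_five_and_surjective_three`, `BCDTTheoremB`: for every
absolutely irreducible `ρ̄ : Γ_ℚ → GL₂(𝔽₅)` with cyclotomic determinant an `E/ℚ` with `E[5] ≅ ρ̄` and
`ρ̄_{E,3}` surjective), which implies the `3`–`5` switch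
(`CDT_three_five_switch_of_exists_isTorsionGaloisRep_five_and_surjective_three`, `CDTTheorem712`).
[cite: ConradDiamondTaylor1999, Thm. 7.1.2 (proof, p. 556)] -/
theorem CDT_theorem_7_1_2_of_CDT721_722_723_auxiliaryCurve (h721 : CDT_theorem_7_2_1)
    (h722 : CDT_theorem_7_2_2) (h723 : CDT_lemma_7_2_3_isModular)
    (hE : exists_isTorsionGaloisRep_five_and_surjective_three) : CDT_theorem_7_1_2 :=
  CDT_theorem_7_1_2_of_CDT721_722_723_switch h721 h722 h723
    (CDT_three_five_switch_of_exists_isTorsionGaloisRep_five_and_surjective_three hE)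

/-- **Theorem 7.1.2 is equivalent to its "weaker version" Theorem 7.2.1** (CDT, p. 553: "We will
first need to show that we have some flexibility in the choice of `E`. Theorem 7.2.1 …") granted
Theorem 7.2.2, Lemma 7.2.3 and the `3`–`5` switch: `CDT_theorem_7_2_1_of_7_1_2` (`BCDTTheoremB`,
forgetting the hypothesis on `ρ̄_{E,3}`) and `CDT_theorem_7_1_2_of_CDT721_722_723_switch`.
[cite: ConradDiamondTaylor1999, §7.2 (pp. 553–556)] -/
theorem CDT_theorem_7_1_2_iff_CDT721 (h722 : CDT_theorem_7_2_2) (h723 : CDT_lemma_7_2_3_isModular)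
    (hsw : CDT_three_five_switch) : CDT_theorem_7_1_2 ↔ CDT_theorem_7_2_1 :=
  ⟨CDT_theorem_7_2_1_of_7_1_2, fun h721 ↦ CDT_theorem_7_1_2_of_CDT721_722_723_switch h721 h722 h723 hsw⟩

/-! ## `27 ∣ N_E` forces wild ramification of `E[5]` above `3` — unconditionally -/

open EllipticCurves in
/-- **`27 ∣ N_E` ⇒ `E[5]` is wildly ramified above `3`** — proved: for an elliptic curve `E / ℚ` with
`27 ∣ N_E` and any framed model `ρ̄` of `E[5]`, some element `σ` of some wild ramification group
`Γ_ℚ^u(𝔓)` (`u > 0`, `𝔓` a prime of `ℚ̄` above the place `v ∋ 3`) has `ρ̄(σ) ≠ 1`.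
`exists_mem_absUpperRamificationSubgroup_ne_one_of_dvd_conductorNorm_of_ogg3` with Ogg's formula at
`p = 3` discharged: `27 ∣ N_E` gives `δ₃(E) ≠ 0`, hence `Sw_𝔓(V₅ E) ≠ 0`, so `V₅ E` is not tame at `𝔓`
and a wild element moving a point of some `E[5ⁿ]` already moves a point of `E[5]` (its action has
`3`-power order).  CDT, Introduction, p. 522: `27 ∤ N_E` "if and only if `E` acquires semistable
reduction over a tamely ramified extension of `ℚ₃`", in the direction used on pp. 553, 556.
[cite: ConradDiamondTaylor1999, Introduction (p. 522) and proof of Thm. 7.1.2 (p. 556)] -/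
theorem exists_mem_absUpperRamificationSubgroup_ne_one_of_twentySeven_dvd_conductorNorm
    (W : WeierstrassCurve ℚ) [W.IsElliptic] {ρ : ModPGaloisRep ℚ (ZMod 5) 2}
    (hρ : W.IsTorsionGaloisRep 5 ρ) (h27 : 27 ∣ W.conductorNorm ℤ) :
    ∃ v : HeightOneSpectrum (𝓞 ℚ), ((3 : ℕ) : 𝓞 ℚ) ∈ v.asIdeal ∧ ∃ 𝔓 ∈ v.primesAbove,
      ∃ u : ℝ, 0 < u ∧ ∃ σ ∈ absUpperRamificationSubgroup (𝓞 ℚ) 𝔓 u, ρ σ ≠ 1 :=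
  exists_mem_absUpperRamificationSubgroup_ne_one_of_dvd_conductorNorm_of_ogg3 W (oggThree_five W) hρ
    h27

/-- **`ρ̄_{E,5}` tamely ramified above `3` ⇒ `27 ∤ N_E`** — proved, for every elliptic curve `E / ℚ`
and every framed model `ρ̄` of `E[5]`: the step "`E` acquires semistable reduction over a tame
extension of `ℚ₃`, so `27 ∤ N_E`" of BCDT §2.2, case 1 (CDT 1999, Introduction, p. 522);
`not_dvd_conductorNorm_of_isTamelyRamifiedAbove_of_ogg3` with Ogg's formula at `p = 3` discharged.
[cite: ConradDiamondTaylor1999, Introduction (p. 522)] -/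
theorem not_twentySeven_dvd_conductorNorm_of_isTamelyRamifiedAbove_three (W : WeierstrassCurve ℚ)
    [W.IsElliptic] {ρ : ModPGaloisRep ℚ (ZMod 5) 2} (hρ : W.IsTorsionGaloisRep 5 ρ)
    (htame : ρ.IsTamelyRamifiedAbove 3) : ¬ 27 ∣ W.conductorNorm ℤ :=
  not_dvd_conductorNorm_of_isTamelyRamifiedAbove_of_ogg3 W (oggThree_five W) hρ htame

/-- **`27 ∣ N_E` ⇒ the image of `ρ̄_{E,5}` contains an element of order `3`** — proved (the
arithmetic half of the hidden lemma of CDT Thm. 7.2.4): `exists_orderOf_eq_three_of_dvd_conductorNorm_of_ogg3`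
with Ogg's formula at `p = 3` discharged.
[cite: ConradDiamondTaylor1999, §7.2, proof of Thm. 7.1.2 (p. 556) and Introduction (p. 522)] -/
theorem exists_orderOf_eq_three_of_twentySeven_dvd_conductorNorm (W : WeierstrassCurve ℚ)
    [W.IsElliptic] {ρ : ModPGaloisRep ℚ (ZMod 5) 2} (hρ : W.IsTorsionGaloisRep 5 ρ)
    (h27 : 27 ∣ W.conductorNorm ℤ) : ∃ σ : absoluteGaloisGroup ℚ, orderOf (ρ σ) = 3 :=
  exists_orderOf_eq_three_of_dvd_conductorNorm_of_ogg3 W (oggThree_five W) hρ h27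

/-- **The hidden lemma of CDT Thm. 7.2.4, proved**: for an elliptic curve `E / ℚ`, if
`ρ̄_{E,5}|_{ℚ(√5)}` is not absolutely irreducible then `27 ∤ N_E` (so that Thm. 7.1.2 applies to `E`,
which is how Thm. 7.2.4 is "immediate from Theorem 7.1.2", p. 556).
`not_dvd_conductorNorm_of_not_isAbsIrreducibleOverSqrt_of_ogg3` with Ogg's formula at `p = 3`
discharged: an element of order `3` in the image together with `det ρ̄_{E,5} = χ̄₅` (the Weil pairing)
forces absolute irreducibility over `ℚ(√5)` (`isAbsIrreducibleOverSqrt_five_of_orderOf_eq_three`,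
`CDTModularityProofs`). [cite: ConradDiamondTaylor1999, Thm. 7.2.4 (p. 556) with proof of Lemma 7.2.3 (p. 554)] -/
theorem not_twentySeven_dvd_conductorNorm_of_not_isAbsIrreducibleOverSqrt_five
    (W : WeierstrassCurve ℚ) [W.IsElliptic] {ρ : ModPGaloisRep ℚ (ZMod 5) 2}
    (hρ : W.IsTorsionGaloisRep 5 ρ) (h : ¬ ρ.IsAbsIrreducibleOverSqrt 5) :
    ¬ 27 ∣ W.conductorNorm ℤ :=
  not_dvd_conductorNorm_of_not_isAbsIrreducibleOverSqrt_of_ogg3 W (oggThree_five W) hρ h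

/-- **`27 ∣ N_E` ⇒ `ρ̄_{E,5}|_{ℚ(√5)}` is absolutely irreducible**, for every elliptic curve `E / ℚ`
and every framed model `ρ̄` of `E[5]` — the hidden lemma of Thm. 7.2.4 in positive form
(contrapositive of `not_twentySeven_dvd_conductorNorm_of_not_isAbsIrreducibleOverSqrt_five`).
[cite: ConradDiamondTaylor1999, Thm. 7.2.4 (p. 556) with proof of Lemma 7.2.3 (p. 554)] -/
theorem isAbsIrreducibleOverSqrt_five_of_twentySeven_dvd_conductorNorm (W : WeierstrassCurve ℚ)
    [W.IsElliptic] {ρ : ModPGaloisRep ℚ (ZMod 5) 2} (hρ : W.IsTorsionGaloisRep 5 ρ)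
    (h27 : 27 ∣ W.conductorNorm ℤ) : ρ.IsAbsIrreducibleOverSqrt 5 := by
  by_contra h
  exact not_twentySeven_dvd_conductorNorm_of_not_isAbsIrreducibleOverSqrt_five W hρ h h27

/-! ## Theorem 7.2.4, Theorem A and Theorem B on their printed deep inputs alone -/

/-- **Conrad–Diamond–Taylor 1999, Theorem 7.2.4 from Theorems 7.1.2 and 7.2.2 — nothing else**
(JAMS 12 (1999), p. 556: "we record the following strengthening of Theorem 7.2.2, immediate from
Theorem 7.1.2"): if `ρ̄_{E,5}|_{ℚ(√5)}` is absolutely irreducible, the hypothesis of 7.2.4 says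
`ρ̄_{E,5}` is modular and `E` is modular by Thm. 7.2.2; otherwise `27 ∤ N_E`
(`not_twentySeven_dvd_conductorNorm_of_not_isAbsIrreducibleOverSqrt_five`, proved) and `E` is modular
by Thm. 7.1.2.  Supersedes `CDT_theorem_7_2_4_of_7_1_2_of_7_2_2` (`CDTModularityProofs`, there on
Ogg–Saito in Galois form) and `CDT_theorem_7_2_4_of_7_1_2_of_7_2_2_of_ogg3`.
[cite: ConradDiamondTaylor1999, Thm. 7.2.4] -/
theorem CDT_theorem_7_2_4_of_CDT712_722 (h712 : CDT_theorem_7_1_2) (h722 : CDT_theorem_7_2_2) :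
    CDT_theorem_7_2_4 :=
  CDT_theorem_7_2_4_of_7_1_2_of_7_2_2_of_ogg3 h712 h722 oggThree_five

/-- **Conrad–Diamond–Taylor 1999, Theorem 7.2.4 from Theorems 7.2.1, 7.2.2, Lemma 7.2.3 and the
`3`–`5` switch — nothing else**: `CDT_theorem_7_2_4_of_CDT712_722` applied to
`CDT_theorem_7_1_2_of_CDT721_722_723_switch`.  Trust base of the named fact `CDT_theorem_7_2_4`
(`BCDTModularity`) inside the tree after this file: {CDT Thm. 7.2.1, Thm. 7.2.2, Lemma 7.2.3
(modularity conclusion), the `3`–`5` switch (p. 556)}. [cite: ConradDiamondTaylor1999, Thm. 7.2.4] -/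
theorem CDT_theorem_7_2_4_of_CDT721_722_723_switch (h721 : CDT_theorem_7_2_1)
    (h722 : CDT_theorem_7_2_2) (h723 : CDT_lemma_7_2_3_isModular) (hsw : CDT_three_five_switch) :
    CDT_theorem_7_2_4 :=
  CDT_theorem_7_2_4_of_CDT712_722 (CDT_theorem_7_1_2_of_CDT721_722_723_switch h721 h722 h723 hsw) h722

/-- **BCDT Theorem 2.2.2 for a given `E / ℚ`, from Theorem B and CDT Thms. 7.1.2, 7.2.2 — nothing
else** (BCDT 2001, §2.2: "Theorem A follows from Theorem B and Theorem 7.2.4 of [CDT]"; here 7.2.4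
is `CDT_theorem_7_2_4_of_CDT712_722`).  Supersedes `isModular_of_theoremB_of_CDT712_722`
(`CDTModularityProofs`, there on Ogg–Saito in Galois form). [cite: BCDTJAMS2001, Theorem 2.2.2] -/
theorem isModular_of_theoremB_CDT712_722 (hB : theoremB) (h712 : CDT_theorem_7_1_2)
    (h722 : CDT_theorem_7_2_2) (W : WeierstrassCurve ℚ) [W.IsElliptic]
    [NeZero (W.conductorNorm ℤ)] : IsModular W :=
  isModular_of_theoremB_of_CDT hB (CDT_theorem_7_2_4_of_CDT712_722 h712 h722) W

/-- **BCDT Theorem A** (`Literature.NumberTheory.EllipticCurves.ModularForms.exists_isNewformOf`, the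
Modularity Theorem in the tree's form) **from Theorem B and CDT Thms. 7.1.2, 7.2.2 — nothing else**:
`exists_isNewformOf_of_theoremB_of_CDT` (`BCDTModularity` Part 3) with `CDT_theorem_7_2_4`
discharged by `CDT_theorem_7_2_4_of_CDT712_722`.  Supersedes
`exists_isNewformOf_of_theoremB_of_CDT712_722` (`CDTModularityProofs`, there on Ogg–Saito in Galois
form at `ℓ = 5` for every `E / ℚ`). [cite: BCDTJAMS2001, Theorem A] -/
theorem exists_isNewformOf_of_theoremB_CDT712_722 (hB : theoremB) (h712 : CDT_theorem_7_1_2)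
    (h722 : CDT_theorem_7_2_2) : EllipticCurves.ModularForms.exists_isNewformOf :=
  exists_isNewformOf_of_theoremB_of_CDT hB (CDT_theorem_7_2_4_of_CDT712_722 h712 h722)

/-- **BCDT Theorem A from Theorem B and the printed inputs of CDT §7.2 — nothing else**:
`exists_isNewformOf_of_theoremB_of_CDT` with `CDT_theorem_7_2_4` discharged by
`CDT_theorem_7_2_4_of_CDT721_722_723_switch`; the discharge of
`exists_isNewformOf_of_theoremB_of_CDT721_722_723_switch_of_ogg3`.  (With Theorem B granted the
switch is avoidable: `BCDTTheoremACasesProofs` runs BCDT's three cases instead.)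
[cite: BCDTJAMS2001, Theorem A] -/
theorem exists_isNewformOf_of_theoremB_CDT721_722_723_switch (hB : theoremB)
    (h721 : CDT_theorem_7_2_1) (h722 : CDT_theorem_7_2_2) (h723 : CDT_lemma_7_2_3_isModular)
    (hsw : CDT_three_five_switch) : EllipticCurves.ModularForms.exists_isNewformOf :=
  exists_isNewformOf_of_theoremB_of_CDT hB (CDT_theorem_7_2_4_of_CDT721_722_723_switch h721 h722 h723 hsw)

/-- **BCDT Theorem 2.2.1, the tame case, from the auxiliary curve and CDT Thm. 7.2.1 — nothing
else** (§2.2, proof of Thm. 2.2.1, case 1: "`ρ̄` is tamely ramified at `3` … In the first case, `E`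
is modular by Theorem 7.2.1 of [CDT]"): for a continuous, absolutely irreducible
`ρ̄ : Γ_ℚ → GL₂(𝔽₅)` with cyclotomic determinant, tamely ramified above `3`, there is a modular
elliptic curve `E / ℚ` with `E[5] ≅ ρ̄`: take `E` with `E[5] ≅ ρ̄` and `ρ̄_{E,3}` surjective (`hE`);
`27 ∤ N_E` by `not_twentySeven_dvd_conductorNorm_of_isTamelyRamifiedAbove_three` (proved);
`ρ̄_{E,3}|_{ℚ(√-3)}` is absolutely irreducible; so `E` is modular by CDT Thm. 7.2.1.  The discharge of
`exists_isTorsionGaloisRep_and_isModular_of_isTamelyRamifiedAbove_of_ogg3`; supersedes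
`exists_isTorsionGaloisRep_and_isModular_of_isTamelyRamifiedAbove` (`BCDTTheoremB`, there on
Ogg–Saito in Galois form). [cite: BCDTJAMS2001, §2.2 (proof of Thm. 2.2.1, case 1)] -/
theorem exists_isTorsionGaloisRep_and_isModular_of_isTamelyRamifiedAbove_of_auxiliaryCurve_CDT721
    (hE : exists_isTorsionGaloisRep_five_and_surjective_three) (h721 : CDT_theorem_7_2_1)
    (ρ : ModPGaloisRep ℚ (ZMod 5) 2) (hirr : FramedRep.IsAbsolutelyIrreducible ρ)
    (hdet : ∀ σ : absoluteGaloisGroup ℚ,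
      Matrix.GeneralLinearGroup.det (ρ σ) = modPCyclotomicCharacterZMod ℚ 5 σ)
    (htame : ρ.IsTamelyRamifiedAbove 3) :
    ∃ (W : WeierstrassCurve ℚ) (_ : W.IsElliptic) (_ : NeZero (W.conductorNorm ℤ)),
      W.IsTorsionGaloisRep 5 ρ ∧ IsModular W :=
  exists_isTorsionGaloisRep_and_isModular_of_isTamelyRamifiedAbove_of_ogg3 hE h721 oggThree_five ρ hirr
    hdet htame

/-- **BCDT Theorem B = Theorem 2.2.1 from its three printed deep inputs — nothing else**: Theorem B
(`Literature.NumberTheory.Automorphic.BCDT.theoremB`) follows from (i) its wild case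
(`exists_isTorsionGaloisRep_and_isModular_of_not_isTamelyRamifiedAbove`, BCDT §§3–9 with
Thms. 1.4.1–1.4.2, 2.1.2–2.1.6, Langlands–Tunnell), (ii) the auxiliary curve of the `3`–`5` switch
(`exists_isTorsionGaloisRep_five_and_surjective_three`, [SBT] §1 + Hilbert irreducibility) and
(iii) CDT Thm. 7.2.1 — the tame case, the case distinction and "`E` modular ⇒ `ρ̄_{E,5}` modular"
being theorems of the tree.  The discharge of `theoremB_of_wild_of_auxiliaryCurve_of_CDT721_of_ogg3`;
supersedes `theoremB_of_wild_of_auxiliaryCurve_of_CDT721` (`BCDTTheoremB`, there on Ogg–Saito in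
Galois form).  Trust base of Theorem B inside the tree after this file: {(i), (ii), (iii)}.
[cite: BCDTJAMS2001, Theorem 2.2.1] -/
theorem theoremB_of_wild_auxiliaryCurve_CDT721
    (hW : exists_isTorsionGaloisRep_and_isModular_of_not_isTamelyRamifiedAbove)
    (hE : exists_isTorsionGaloisRep_five_and_surjective_three) (h721 : CDT_theorem_7_2_1) :
    theoremB :=
  theoremB_of_wild_of_auxiliaryCurve_of_CDT721_of_ogg3 hW hE h721 oggThree_five

/-- **The Modularity Theorem (BCDT Theorem A, `exists_isNewformOf`) from its five printed deep
inputs — nothing else.**  Granted (i) the wild case of BCDT Thm. 2.2.1, (ii) the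
Shepherd-Barron–Taylor auxiliary curve (the `3`–`5` switch of both papers), (iii) CDT Thm. 7.2.1,
(iv) CDT Thm. 7.2.2 and (v) the modularity conclusion of CDT Lemma 7.2.3 (Elkies), every elliptic
curve over `ℚ` is modular; the discharge of
`exists_isNewformOf_of_wild_of_auxiliaryCurve_of_CDT721_722_723_of_ogg3`.  This is the trust base of
the Modularity Theorem inside the tree along the CDT route after this file (no conductor /
Galois-module input remains). [cite: BCDTJAMS2001, Theorem A] -/
theorem exists_isNewformOf_of_wild_auxiliaryCurve_CDT721_722_723
    (hW : exists_isTorsionGaloisRep_and_isModular_of_not_isTamelyRamifiedAbove)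
    (hE : exists_isTorsionGaloisRep_five_and_surjective_three) (h721 : CDT_theorem_7_2_1)
    (h722 : CDT_theorem_7_2_2) (h723 : CDT_lemma_7_2_3_isModular) :
    EllipticCurves.ModularForms.exists_isNewformOf :=
  exists_isNewformOf_of_wild_of_auxiliaryCurve_of_CDT721_722_723_of_ogg3 hW hE h721 h722 h723
    oggThree_five

end Literature.NumberTheory.Automorphic.BCDT

namespace Literature.NumberTheory.Automorphic

/-- **lang.S33 from the five printed deep inputs — nothing else**: granted the five named facts of
`BCDT.exists_isNewformOf_of_wild_auxiliaryCurve_CDT721_722_723`, every elliptic `E / ℚ` has a cusp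
form `f ∈ S₂(Γ₀(N))` with `a_p(f) = p + 1 - #E(𝔽_p)` for `p ∤ N Δ_E`
(`exists_cuspForm_coeff_eq_frobeniusTrace_of_exists_isNewformOf`, `LangWave0Proofs`); the discharge
of `exists_cuspForm_coeff_eq_frobeniusTrace_of_wild_of_auxiliaryCurve_of_CDT721_722_723_of_ogg3`.
[cite: BCDTJAMS2001, Theorem 2.2.2] -/
theorem exists_cuspForm_coeff_eq_frobeniusTrace_of_wild_auxiliaryCurve_CDT721_722_723
    (hW : BCDT.exists_isTorsionGaloisRep_and_isModular_of_not_isTamelyRamifiedAbove)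
    (hE : BCDT.exists_isTorsionGaloisRep_five_and_surjective_three)
    (h721 : BCDT.CDT_theorem_7_2_1) (h722 : BCDT.CDT_theorem_7_2_2)
    (h723 : BCDT.CDT_lemma_7_2_3_isModular) :
    exists_cuspForm_coeff_eq_frobeniusTrace :=
  exists_cuspForm_coeff_eq_frobeniusTrace_of_exists_isNewformOf
    (BCDT.exists_isNewformOf_of_wild_auxiliaryCurve_CDT721_722_723 hW hE h721 h722 h723)

/-- **lang.S33 from Theorem B and the printed inputs of CDT §7.2 — nothing else**: the discharge of
`exists_cuspForm_coeff_eq_frobeniusTrace_of_theoremB_of_CDT721_722_723_switch_of_ogg3`.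
[cite: BCDTJAMS2001, Theorem 2.2.2] -/
theorem exists_cuspForm_coeff_eq_frobeniusTrace_of_theoremB_CDT721_722_723_switch
    (hB : BCDT.theoremB) (h721 : BCDT.CDT_theorem_7_2_1) (h722 : BCDT.CDT_theorem_7_2_2)
    (h723 : BCDT.CDT_lemma_7_2_3_isModular) (hsw : BCDT.CDT_three_five_switch) :
    exists_cuspForm_coeff_eq_frobeniusTrace :=
  exists_cuspForm_coeff_eq_frobeniusTrace_of_exists_isNewformOf
    (BCDT.exists_isNewformOf_of_theoremB_CDT721_722_723_switch hB h721 h722 h723 hsw)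

end Literature.NumberTheory.Automorphic
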